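import Summits.CriticalPhenomena.CardyFormulaZ2.Theorems.CardyComplexConeEdgePrecompactUFRSJunctionGateExtract
import Literature.Probability.Percolation.FourArmGarbanFencedToSides
import Literature.Probability.Percolation.FiniteEnergy

/-!
# The junction gate from an exploration: the probability of the blocking arch (generic regions)
(line `qkz-strip-boundary-arm` of crux `CardyComplexCone.EdgePrecompact`, stmt-CriticalPhenomena-11387;
second file of the registered sub-goal S1 = `ufrs_junctionGate_prob` of the per-scale junction
bound HJ-S, lead c5 wave 3; registered anchor `real_ufrsGateWith_ge`)

**Theorem** (`real_ufrsGateWith_ge`, the decoupling step of Kesten's fence construction run with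
the exploration of Basu–Sapozhnikov). Regions `FA ⊆ RA ⊆ RAfin` (finite), `RB`, `FB` as in the
gate `ufrsGateWith` (`…UFRSJunctionGate.lean`), a box `[L, R] × [B, T]` and a dual rectangle
`u + ([0, m-1] × [-1, n'])` of faces contained in `RB`, with top face row `u₁ + n' = T` and bottom
face row inside `FB`, all faces of `RB` with abscissae in `[L, R-1]` and ordinates `≤ T`, all of
`FB` with ordinates `< B`. Let `A` be the event "the explored set `U = explSet FA RA ω` contains an
open left-right crossing of the box" and `q ≤ P_{1/2}(TB*_u(m, n'))` (a closed dual top-bottom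
crossing of the dual rectangle). Then `q · P(A) ≤ P(ufrsGateWith RA FA RB FB)`.

Proof. Decompose along the value `b` of the explored set (`Ψ ω = RAfin ∩ U`, countably many
values): `A ∩ {Ψ = b}` is determined by the pairs inside `RAfin` touching `b`
(`explSet_eq_of_agree_on_touching` after discarding the pairs outside `RAfin`, which the
exploration never uses, and `openConnIn_of_agree` for the crossing inside `b`), while the event
`E b` = "the configuration deprived of ALL pairs touching `b` has a closed dual crossing of the
dual rectangle" is determined by the complementary pairs and has probability `≥ q` (it contains
the decreasing event `TB*_u(m, n')`). The conditional-independence lemma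
`bondPercolation_real_inter_memDep_ge` (`FiniteEnergy.lean`) gives
`q · P(A) ≤ P(A ∩ {ω ∈ E (Ψ ω)})`, and on the latter event (and `ω ⊆ E(ℤ²)`, almost surely) the
dual crossing of `ω ∖ {pairs touching U}` is a face walk whose separating edges are `ω`-closed or
touch `U`, so `ufrsGateWith_of_exploration` (`…UFRSJunctionGateExtract.lean`) produces the gate.

References: H. Kesten, Comm. Math. Phys. 109 (1987), §2, Lemma 4 (fences at constant cost);
D. Basu, A. Sapozhnikov, Electron. Commun. Probab. 22 (2017), §2, (2.3) (conditioning on the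
explored set); G. Grimmett, *Percolation* (1999), §7.3 p. 167 (conditional independence given a
random set), §11.2 (duality).
-/

namespace Summit.CriticalPhenomena.CardyFormulaZ2.Cruxes.EdgePrecompact.QkzStripBoundaryArm

open MeasureTheory Filter Set Metric
open scoped Topology BigOperators Pointwise
open Literature.Probability.LatticeModels Literature.Probability.Percolation
open Literature.Probability.RandomPlanarGeometry (DobrushinDomain)
open Summit.CriticalPhenomena.CardyFormulaZ2.Theses.CardyComplexCone

noncomputable section

open SimpleGraph

/-! ## Locality of the explored set -/

/-- Configurations with the same open pairs inside `In ∪ Blk` have the same explored set. -/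
theorem explSet_eq_of_agree_inside_HJ {V : Type*} {In Blk : Set V} {ω₁ ω₂ : BondConfig V}
    (h : ∀ a ∈ In ∪ Blk, ∀ b ∈ In ∪ Blk, (s(a, b) ∈ ω₁ ↔ s(a, b) ∈ ω₂)) :
    explSet In Blk ω₁ = explSet In Blk ω₂ := by
  ext v
  rw [mem_explSet_iff, mem_explSet_iff]
  refine or_congr_right (and_congr_right fun _ => exists_congr fun u => and_congr_right fun _ => ?_)
  exact ⟨fun hc => BlockExploration.openConnIn_of_agree hc fun a ha b hb hab => (h a ha b hb).1 hab,
    fun hc => BlockExploration.openConnIn_of_agree hc fun a ha b hb hab => (h a ha b hb).2 hab⟩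

open scoped Classical in
/-- **The value of the explored set together with a crossing inside it is a local event**: if
`ω` and `ω'` agree on the pairs inside `RAfin ⊇ In ∪ Blk` touching `b`, the explored set of `ω`
traces `b` on `RAfin`, and `ω` has an open path inside `S ∩ explSet` from `x` to `y`, then the
same holds for `ω'`. -/
theorem explSet_transfer_HJ {In Blk S : Set (Site 2)} {RAfin b : Finset (Site 2)} (hR : In ∪ Blk ⊆ ↑RAfin)
    {ω ω' : BondConfig (Site 2)}
    (hagree : ∀ e ∈ RAfin.sym2, (∃ v ∈ b, v ∈ e) → (e ∈ ω ↔ e ∈ ω'))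
    (hb : RAfin.filter (· ∈ explSet In Blk ω) = b) :
    explSet In Blk ω' = explSet In Blk ω ∧ RAfin.filter (· ∈ explSet In Blk ω') = b ∧
      ∀ x y : Site 2, ω ∈ openConnIn (S ∩ explSet In Blk ω) x y → ω' ∈ openConnIn (S ∩ explSet In Blk ω') x y := by
  classical
  set U := explSet In Blk ω with hU
  have hUR : U ⊆ ↑RAfin := (explSet_subset In Blk ω).trans hR
  have hUb : ∀ v, v ∈ U ↔ v ∈ b := fun v => by
    rw [← hb, Finset.mem_filter]
    exact ⟨fun hv => ⟨hUR hv, hv⟩, fun hv => hv.2⟩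
  -- discard the pairs outside `RAfin`
  set ω₁ : BondConfig (Site 2) := ω ∩ ↑RAfin.sym2 with hω₁
  set ω₂ : BondConfig (Site 2) := ω' ∩ ↑RAfin.sym2 with hω₂
  have hin : ∀ (ν : BondConfig (Site 2)), ∀ a ∈ In ∪ Blk, ∀ c ∈ In ∪ Blk, (s(a, c) ∈ ν ↔ s(a, c) ∈ ν ∩ ↑RAfin.sym2) := by
    intro ν a ha c hc
    simp only [Set.mem_inter_iff, Finset.mem_coe, Finset.mk_mem_sym2_iff]
    exact ⟨fun h => ⟨h, hR ha, hR hc⟩, fun h => h.1⟩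
  have h1 : explSet In Blk ω₁ = U := (explSet_eq_of_agree_inside_HJ (hin ω)).symm
  have h12 : ∀ e : Sym2 (Site 2), (∃ v ∈ U, v ∈ e) → (e ∈ ω₁ ↔ e ∈ ω₂) := by
    rintro e ⟨v, hv, hve⟩
    simp only [hω₁, hω₂, Set.mem_inter_iff, Finset.mem_coe]
    by_cases he : e ∈ RAfin.sym2
    · rw [hagree e he ⟨v, (hUb v).1 hv, hve⟩]
    · simp [he]
  have h2 : explSet In Blk ω₂ = U := explSet_eq_of_agree_on_touching h12 h1
  have h' : explSet In Blk ω' = U := (explSet_eq_of_agree_inside_HJ (hin ω')).trans h2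
  refine ⟨h', by rw [h']; exact hb, fun x y hxy => ?_⟩
  rw [h']
  refine BlockExploration.openConnIn_of_agree hxy fun a ha c hc hac => ?_
  have hmem : s(a, c) ∈ RAfin.sym2 := Finset.mk_mem_sym2_iff.2 ⟨hUR ha.2, hUR hc.2⟩
  exact (hagree _ hmem ⟨a, (hUb a).1 ha.2, Sym2.mem_mk_left _ _⟩).1 hac

/-! ## Removing the pairs touching a finite set is measurable and monotone -/

/-- `ω ↦ ω ∩ T` is measurable. -/
theorem measurable_inter_const_HJ (T : Set (Sym2 (Site 2))) : Measurable fun ω : BondConfig (Site 2) => ω ∩ T := by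
  rw [measurable_set_iff]
  intro e
  simp only [Set.mem_inter_iff]
  exact (measurable_set_mem e).and measurable_const

/-! ## The generic probability bound -/

/-- **The blocking arch at constant cost** (registered anchor `real_ufrsGateWith_ge` of
stmt-CriticalPhenomena-11387): with the notation of the module docstring,
`q · P(U contains an open left-right crossing of [L, R] × [B, T]) ≤ P(ufrsGateWith RA FA RB FB)`
whenever `q ≤ P_{1/2}(TB*_u(m, n'))`. -/
theorem real_ufrsGateWith_ge : ∀ (RA FA RB FB : Set (Site 2)) (RAfin : Finset (Site 2)) (L R B T : ℤ) (u : Site 2) (m n' : ℕ) (q : ℝ), FA ⊆ RA → RA ⊆ ↑RAfin → (∀ z ∈ RB, L ≤ z 0 ∧ z 0 + 1 ≤ R ∧ z 1 ≤ T) → (∀ z ∈ FB, z 1 < B) → (∀ f : Site 2, u 0 ≤ f 0 → f 0 + 1 ≤ u 0 + m → u 1 - 1 ≤ f 1 → f 1 ≤ u 1 + n' → f ∈ RB) → u 1 + n' = T → (∀ f : Site 2, u 0 ≤ f 0 → f 0 + 1 ≤ u 0 + m → f 1 = u 1 - 1 → f ∈ FB) → 0 ≤ q → q ≤ (bondPercolation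 (zdGraph 2) half).real (dualTBCrossingAt u m n') → q * (bondPercolation (zdGraph 2) half).real {ω : BondConfig (Site 2) | ∃ x y : Site 2, x 0 = L ∧ y 0 = R ∧ ω ∈ openConnIn ({z : Site 2 | L ≤ z 0 ∧ z 0 ≤ R ∧ B ≤ z 1 ∧ z 1 ≤ T} ∩ explSet FA RA ω) x y} ≤ (bondPercolation (zdGraph 2) half).real (ufrsGateWith RA FA RB FB) := by
  intro RA FA RB FB RAfin L R B T u m n' q hFA hRA hRB hFB hRBu hT hFBu hq0 hq
  classical
  set μ := bondPercolation (zdGraph 2) half with hμ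
  set Bar : Set (Site 2) := {z : Site 2 | L ≤ z 0 ∧ z 0 ≤ R ∧ B ≤ z 1 ∧ z 1 ≤ T} with hBar
  set A : Set (BondConfig (Site 2)) := {ω | ∃ x y : Site 2, x 0 = L ∧ y 0 = R ∧
    ω ∈ openConnIn (Bar ∩ explSet FA RA ω) x y} with hA
  -- the statistic: the trace of the explored set on `RAfin` (= the explored set)
  set Ψ : BondConfig (Site 2) → Finset (Site 2) := fun ω => RAfin.filter (· ∈ explSet FA RA ω) with hΨ
  have hIB : FA ∪ RA ⊆ ↑RAfin := Set.union_subset (hFA.trans hRA) hRA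
  -- supports
  set S : Finset (Site 2) → Set (Sym2 (Site 2)) := fun b => ↑(RAfin.sym2.filter fun e => ∃ v ∈ b, v ∈ e) with hS
  set Tc : Finset (Site 2) → Set (Sym2 (Site 2)) := fun b => {e | ∀ v ∈ b, v ∉ e} with hTc
  set E : Finset (Site 2) → Set (BondConfig (Site 2)) := fun b => {ω | ω ∩ Tc b ∈ dualTBCrossingAt u m n'} with hE
  -- (1) `A ∩ {Ψ = b}` is determined by `S b`
  have hdet : ∀ b, DeterminedBy (A ∩ Ψ ⁻¹' {b}) (S b) := by
    intro b
    rw [determinedBy_iff]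
    have key : ∀ ω ω' : BondConfig (Site 2), ω ∩ S b = ω' ∩ S b → ω ∈ A ∩ Ψ ⁻¹' {b} → ω' ∈ A ∩ Ψ ⁻¹' {b} := by
      rintro ω ω' hωω' ⟨⟨x, y, hx, hy, hconn⟩, hΨb⟩
      have hΨb' : RAfin.filter (· ∈ explSet FA RA ω) = b := hΨb
      have hagree : ∀ e ∈ RAfin.sym2, (∃ v ∈ b, v ∈ e) → (e ∈ ω ↔ e ∈ ω') := by
        intro e he hv
        have heS : e ∈ S b := by
          simp only [hS, Finset.coe_filter, Set.mem_setOf_eq]; exact ⟨he, hv⟩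
        constructor
        · intro h; exact ((Set.ext_iff.1 hωω' e).1 ⟨h, heS⟩).1
        · intro h; exact ((Set.ext_iff.1 hωω' e).2 ⟨h, heS⟩).1
      obtain ⟨-, hΨ', htr⟩ := explSet_transfer_HJ (S := Bar) hIB hagree hΨb'
      exact ⟨⟨x, y, hx, hy, htr x y hconn⟩, hΨ'⟩
    intro ω ω' h
    exact ⟨key ω ω' h, key ω' ω h.symm⟩
  have hmeas : ∀ b, MeasurableSet (A ∩ Ψ ⁻¹' {b}) := fun b => (hdet b).measurableSet_of_finset
  -- (2) `E b` is determined by `Tc b`, measurable, and at least as likely as the dual crossing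
  have hEdet : ∀ b, DeterminedBy (E b) (Tc b) := by
    intro b
    rw [determinedBy_iff]
    intro ω ω' h
    simp only [hE, Set.mem_setOf_eq]
    rw [h]
  have hEm : ∀ b, MeasurableSet (E b) := fun b =>
    measurable_inter_const_HJ (Tc b) (measurableSet_dualTBCrossingAt u m n')
  have hEq : ∀ b, q ≤ μ.real (E b) := by
    intro b
    refine hq.trans (measureReal_mono (fun ω hω => ?_) (measure_ne_top _ _))
    simp only [hE, Set.mem_setOf_eq]
    exact isLowerSet_dualTBCrossingAt u m n' Set.inter_subset_left hω
  -- (3) disjoint supports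
  have hdisj : ∀ ω ∈ A, Disjoint (S (Ψ ω)) (Tc (Ψ ω)) := by
    intro ω _
    rw [Set.disjoint_left]
    intro e heS heT
    simp only [hS, Finset.coe_filter, Set.mem_setOf_eq] at heS
    obtain ⟨-, v, hv, hve⟩ := heS
    exact heT v hv hve
  -- (4) the decoupling
  have hmain := bondPercolation_real_inter_memDep_ge (zdGraph 2) half S Tc Ψ E hdet hmeas hEdet hEm hdisj hq0
    (fun ω _ => hEq (Ψ ω))
  -- (5) on `A ∩ {ω ∈ E (Ψ ω)}` the gate occurs (almost surely)
  have hincl : ∀ ω : BondConfig (Site 2), ω ⊆ (zdGraph 2).edgeSet → ω ∈ A ∩ {ω | ω ∈ E (Ψ ω)} →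
      ω ∈ ufrsGateWith RA FA RB FB := by
    rintro ω hω ⟨⟨x, y, hx, hy, hconn⟩, hωE⟩
    have hωE' : ω ∩ Tc (Ψ ω) ∈ dualTBCrossingAt u m n' := hωE
    obtain ⟨W, hWs, hWe⟩ := exists_walk_of_mem_openConnIn hω hconn
    obtain ⟨t, s, W', ht, hs, hW's, hW'd⟩ := exists_faceWalk_of_mem_dualTBCrossingAt hωE'
    refine ufrsGateWith_of_exploration RA FA RB FB ω L R B T x y t s W W' hω hFA hRB hFB hx hy
      (fun z hz => (hWs z hz).1) (fun z hz => (hWs z hz).2) (by rw [ht, hT]) ?_ ?_ ?_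
    · obtain ⟨h1, h2, h3, -⟩ := hW's s (Walk.end_mem_support W')
      exact hFBu s h1 h2 hs
    · intro z hz
      obtain ⟨h1, h2, h3, h4⟩ := hW's z hz
      exact hRBu z h1 h2 h3 h4
    · intro d hd
      by_cases hdω : sepEdge d.fst d.snd ∈ ω
      · right
        have hnot : sepEdge d.fst d.snd ∉ Tc (Ψ ω) := fun hT' => hW'd d hd ⟨hdω, hT'⟩
        simp only [hTc, Set.mem_setOf_eq, not_forall, not_not, exists_prop] at hnot
        obtain ⟨v, hv, hve⟩ := hnot
        exact ⟨v, hve, (Finset.mem_filter.1 hv).2⟩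
      · exact Or.inl hdω
  have hae : (A ∩ {ω | ω ∈ E (Ψ ω)} : Set (BondConfig (Site 2))) ≤ᵐ[μ] (ufrsGateWith RA FA RB FB : Set (BondConfig (Site 2))) :=
    (ae_subset_edgeSet (zdGraph 2) half).mono fun ω hω h => hincl ω hω h
  exact hmain.trans (ENNReal.toReal_mono (measure_ne_top _ _) (measure_mono_ae hae))

end

end Summit.CriticalPhenomena.CardyFormulaZ2.Cruxes.EdgePrecompact.QkzStripBoundaryArm
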